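import Literature.AnabelianGeometry.EtaleTheta.Discharge.Sec1Thm110iiiEndKnitAtProducedDatum
import Literature.AnabelianGeometry.EtaleTheta.Discharge.Sec1Prop18
import HarnessLib

/-!
# [EtTh] Thm. 1.10 (iii) at the PRODUCED cusp data — (b1) WITHOUT (ct): the cusp-pair transport is EXACT, from the plain
# X-level transport `γ_X(D_{xα}) = k·D_{xβ}·k⁻¹` (proof-only)

S. Mochizuki, *The étale theta function …* [EtTh], Publ. RIMS **45** (2009), Thm. 1.10 (iii) p. 256 (PRIMS PDF p. 30)
[cite: MochizukiEtTh2009, Thm 1.10 (iii) p.30], Def. 1.7 p. 27 (`Ċ = Ẋ/⟨ε_± ε_μ⟩`); [SemiAnbd] Thm. 6.5 (iii) p. 72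
[cite: MochizukiSemiAnbd2006, Thm 6.5(iii) p.72]; [GalSect] §4 [cite: MochizukiGalSect2005, §4 p.33].  abc-iut cell, layer L2, node
EtTh:Thm1.10(iii) (K2); seat abc-iut-w5-d029 (gen 9), abc-iut-L2-lead R1074 «GO (x) WITHOUT (ct)»; sequel of p491373.  PROOF-ONLY.

At the produced data (`DotCCusp.ofStructureGroupIso`: `conj = 1`, pair `= (inclX D_x, inclX I_x)`) NO commensurability argument is
needed for (b1): if `inclX(k) ∈ Π^tp_Ċβ` take `c := inclX(k)⁻¹` (no β-side condition); otherwise `c := (inclX(k·Γ₀)·ε_±)⁻¹`, which lies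
in `Π^tp_Ċβ` iff `g₁ := inclX(Γ₀)·ε_± ∉ Π^tp_Ċβ` (`index_dotC` = 2, abc-iut-L6-t1) and works because `g₁` CENTRALISES `inclX(D_{xβ})`
pointwise (abc-iut-L2-t5's `sqrt_conj_inclX_eq`).  Hence `thm110iiiGalSect_ofStructureGroupIso_of_decompTransport`: Thm. 1.10 (iii) AS
TYPED at the two produced data ⟸ {(x₀) the PLAIN X-level transport, `k ∈ Π^tp_{Xβ}` arbitrary · (ΔX) = F-0007 [AbsAnab] Lem. 1.3.8 BY NAME
(inertia component) · β-side `ε_±`-data {`Γ₀`, `g₁ ∉ Π^tp_Ċβ`}, used ONLY when `γ_X` swaps the two `Ẋβ`-cusps over `xβ` · (b3)} — NO (ct),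
NO (sf), nothing else on the α side; and `…_of_isoPreservesCuspidalDecomp`: (x₀) ⟸ [SemiAnbd] Thm. 6.5 (iii) (abc-iut-L3's
`TemperedCurve.IsoPreservesCuspidalDecomp`) + the uniqueness of the cusp of `Xβ` ([EtTh] Def. 2.1, C16), BY NAME.
HONEST DISPLAY: the typed `DotCCusp` does not force `pair.D` to be print's full stabiliser of the cusp of `Ċ` (census clause C7d is not
a field); where `g₁ ∈ Π^tp_Ċ` print's decomposition group is the index-2 overgroup `⟨inclX D_x, g₁⟩` (abc-iut-L2-t5;
`GalSectOrbicurveCuspPairKrull`), not the produced pair — «AS TYPED» is the operative word.  Inputs are cited anabelian results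
carried BY NAME, none asserted; typed ≠ proved; no side taken on [IUTchIII] Cor. 3.12, on which nothing here bears.
-/

namespace Literature.AnabelianGeometry.EtaleTheta

open Literature.AnabelianGeometry.SemiGraphs Literature.AnabelianGeometry.AbsoluteAnabelian GalSect
open MuTwoSetting MuTwoSetting.DotCCusp
open scoped Pointwise

section ProducedTransport

variable {p : ℕ} [Fact p.Prime] {Mα Mβ : MuTwoSetting p} {εα : Mα.GtpC} {εβ : Mβ.GtpC}
  {hCα : Mα.toThetaSetting.Compat} {hCβ : Mβ.toThetaSetting.Compat}
  {Eα : Mα.toThetaSetting.EtaleThetaData} {Eβ : Mβ.toThetaSetting.EtaleThetaData}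
  {γ : Mα.dotC εα ≃ₜ* Mβ.dotC εβ} [T1Space Mα.GtpC] [T1Space Mβ.GtpC]
  (H : Thm110Hypothesis εα εβ hCα hCβ Eα Eβ γ)
  (Sα : Mα.StandardData Eα.toKummerData) (Sβ : Mβ.StandardData Eβ.toKummerData)
  -- the produced cusp data, sides α and β
  (eα : Mα.CLevelData) {xα : Mα.Pt} (hxα : Mα.IsCusp xα) (hDα : Mα.decomp xα ≤ Mα.GtpXdd)
  {S₀α : Subgroup Mα.PiTemp} (hS₀α : S₀α ∈ (cuspPairOf Mα.toTemperedCurve xα).splittings)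
  (κα : haveI := isMulCommutative_pushforward_I eα hxα
    haveI := ((cuspPairOf Mα.toTemperedCurve xα).pushforward Mα.inclX).ID_normal
    KxHat Mα.toTemperedCurve ≃*
      ↥(ContH1.resKer ((cuspPairOf Mα.toTemperedCurve xα).pushforward Mα.inclX).ID
        (⊤ : Subgroup ((cuspPairOf Mα.toTemperedCurve xα).pushforward Mα.inclX).D)
        (((cuspPairOf Mα.toTemperedCurve xα).pushforward Mα.inclX).isClosedComplement_of_mem_splittings
          (map_inclX_mem_splittings eα hS₀α)).le_left))
  (eβ : Mβ.CLevelData) {xβ : Mβ.Pt} (hxβ : Mβ.IsCusp xβ) (hDβ : Mβ.decomp xβ ≤ Mβ.GtpXdd)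
  {S₀β : Subgroup Mβ.PiTemp} (hS₀β : S₀β ∈ (cuspPairOf Mβ.toTemperedCurve xβ).splittings)
  (κβ : haveI := isMulCommutative_pushforward_I eβ hxβ
    haveI := ((cuspPairOf Mβ.toTemperedCurve xβ).pushforward Mβ.inclX).ID_normal
    KxHat Mβ.toTemperedCurve ≃*
      ↥(ContH1.resKer ((cuspPairOf Mβ.toTemperedCurve xβ).pushforward Mβ.inclX).ID
        (⊤ : Subgroup ((cuspPairOf Mβ.toTemperedCurve xβ).pushforward Mβ.inclX).D)
        (((cuspPairOf Mβ.toTemperedCurve xβ).pushforward Mβ.inclX).isClosedComplement_of_mem_splittings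
          (map_inclX_mem_splittings eβ hS₀β)).le_left))

omit [T1Space Mα.GtpC] [T1Space Mβ.GtpC] in
/-- `(Γ ∘ Inn c)(inclX S) = c·inclX(γ_X S)·c⁻¹`. [cite: MochizukiEtTh2009, Prop 1.8 p.28] -/
theorem map_trans_innerAutC_map_inclX (c : Mβ.GtpC) (S : Subgroup Mα.PiTemp) :
    (S.map Mα.inclX).map (H.Γ.trans (Mβ.innerAutC c)).toMulEquiv.toMonoidHom =
      MulAut.conj c • (S.map H.γX.toMulEquiv.toMonoidHom).map Mβ.inclX := by
  have hcomp : (H.Γ.trans (Mβ.innerAutC c)).toMulEquiv.toMonoidHom =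
      (MulAut.conj c).toMonoidHom.comp H.Γ.toMulEquiv.toMonoidHom := by
    ext x; rfl
  rw [hcomp, ← Subgroup.map_map, DotCCusp.map_Γ_map_inclX H S]
  rfl

omit [T1Space Mα.GtpC] [T1Space Mβ.GtpC] in
/-- X-level transport of the inertia from that of the decomposition group and (ΔX). [cite: MochizukiEtTh2009, Thm 1.6 (i) p.24] -/
theorem map_inertia_eq_of_map_decomp_eq {k : Mβ.PiTemp}
    (hX0 : (Mα.decomp xα).map H.γX.toMulEquiv.toMonoidHom = MulAut.conj k • Mβ.decomp xβ)
    (hΔX : Mα.toThetaSetting.toTemperedCurve.DeltaTemp.map H.γX.toMulEquiv.toMonoidHom =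
      Mβ.toThetaSetting.toTemperedCurve.DeltaTemp) :
    (Mα.toThetaSetting.toTemperedCurve.inertia xα).map H.γX.toMulEquiv.toMonoidHom =
      MulAut.conj k • Mβ.toThetaSetting.toTemperedCurve.inertia xβ := by
  change (Mα.decomp xα ⊓ Mα.toThetaSetting.toTemperedCurve.DeltaTemp).map _ =
    MulAut.conj k • (Mβ.decomp xβ ⊓ Mβ.toThetaSetting.toTemperedCurve.DeltaTemp)
  rw [Subgroup.map_inf _ _ _ H.γX.toMulEquiv.injective, hX0, hΔX, Subgroup.smul_inf]
  congr 1
  haveI : Mβ.toThetaSetting.toTemperedCurve.DeltaTemp.Normal := by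
    change Mβ.aug.toMonoidHom.ker.Normal; infer_instance
  exact (Subgroup.Normal.conj_smul_eq_self k Mβ.toThetaSetting.toTemperedCurve.DeltaTemp).symm

/-- **(b1), case `inclX(k) ∈ Π^tp_Ċβ`**: with `c := inclX(k)⁻¹`, `Γ ∘ Inn(c)` carries the produced pair of `α` EXACTLY onto that of `β`
— no β-side condition. [cite: MochizukiEtTh2009, Thm 1.10 (iii) p.30] -/
theorem hpair_ofStructureGroupIso_of_mem {k : Mβ.PiTemp}
    (hX0 : (Mα.decomp xα).map H.γX.toMulEquiv.toMonoidHom = MulAut.conj k • Mβ.decomp xβ)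
    (hΔX : Mα.toThetaSetting.toTemperedCurve.DeltaTemp.map H.γX.toMulEquiv.toMonoidHom =
      Mβ.toThetaSetting.toTemperedCurve.DeltaTemp) :
    (ofStructureGroupIso eα εα hxα hDα hS₀α κα).pair.map (H.Γ.trans (Mβ.innerAutC (Mβ.inclX k)⁻¹)) =
      (ofStructureGroupIso eβ εβ hxβ hDβ hS₀β κβ).pair := by
  refine GalSect.CuspPair.ext' ?_ ?_
  · change (((cuspPairOf Mα.toTemperedCurve xα).pushforward Mα.inclX).D).map _ =
      ((cuspPairOf Mβ.toTemperedCurve xβ).pushforward Mβ.inclX).D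
    rw [GalSect.CuspPair.pushforward_D, GalSect.CuspPair.pushforward_D]
    change ((Mα.decomp xα).map Mα.inclX).map _ = (Mβ.decomp xβ).map Mβ.inclX
    rw [map_trans_innerAutC_map_inclX H, hX0, DotCCusp.map_inclX_conj_smul, smul_smul, ← map_mul, inv_mul_cancel, map_one,
      one_smul]
  · rw [GalSect.CuspPair.map_I]
    change ((Mα.toThetaSetting.toTemperedCurve.inertia xα).map Mα.inclX).map _ =
      (Mβ.toThetaSetting.toTemperedCurve.inertia xβ).map Mβ.inclX
    rw [map_trans_innerAutC_map_inclX H, map_inertia_eq_of_map_decomp_eq H hX0 hΔX, DotCCusp.map_inclX_conj_smul,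
      smul_smul, ← map_mul, inv_mul_cancel, map_one, one_smul]

/-- **(b1), case `inclX(k) ∉ Π^tp_Ċβ`** (γ_X swaps the two `Ẋβ`-cusps over `xβ`): with `c := (inclX(k·Γ₀)·ε_±)⁻¹`, `Γ ∘ Inn(c)` carries
the produced pair of `α` EXACTLY onto that of `β`, because `g₁ = inclX(Γ₀)·ε_±` centralises `inclX(D_{xβ})` pointwise.
[cite: MochizukiEtTh2009, Thm 1.10 (iii) p.30] -/
theorem hpair_ofStructureGroupIso_of_not_mem {k : Mβ.PiTemp}
    (hX0 : (Mα.decomp xα).map H.γX.toMulEquiv.toMonoidHom = MulAut.conj k • Mβ.decomp xβ)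
    (hΔX : Mα.toThetaSetting.toTemperedCurve.DeltaTemp.map H.γX.toMulEquiv.toMonoidHom =
      Mβ.toThetaSetting.toTemperedCurve.DeltaTemp)
    {Γ₀ : Mβ.PiTemp} (hΓ₀ : ∀ d ∈ Mβ.decomp xβ, Mβ.epsPM * Mβ.inclX d * Mβ.epsPM⁻¹ = Mβ.inclX (Γ₀⁻¹ * d * Γ₀)) :
    (ofStructureGroupIso eα εα hxα hDα hS₀α κα).pair.map
        (H.Γ.trans (Mβ.innerAutC (Mβ.inclX (k * Γ₀) * Mβ.epsPM)⁻¹)) =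
      (ofStructureGroupIso eβ εβ hxβ hDβ hS₀β κβ).pair := by
  have hc : (Mβ.inclX (k * Γ₀) * Mβ.epsPM)⁻¹ * Mβ.inclX k = (Mβ.inclX Γ₀ * Mβ.epsPM)⁻¹ := by
    rw [map_mul]; group
  have key : ∀ d ∈ Mβ.decomp xβ,
      (Mβ.inclX Γ₀ * Mβ.epsPM)⁻¹ * Mβ.inclX d * (Mβ.inclX Γ₀ * Mβ.epsPM)⁻¹⁻¹ = Mβ.inclX d := by
    intro d hd
    have h := MuTwoSetting.sqrt_conj_inclX_eq hΓ₀ hd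
    calc (Mβ.inclX Γ₀ * Mβ.epsPM)⁻¹ * Mβ.inclX d * (Mβ.inclX Γ₀ * Mβ.epsPM)⁻¹⁻¹
        = (Mβ.inclX Γ₀ * Mβ.epsPM)⁻¹ * ((Mβ.inclX Γ₀ * Mβ.epsPM) * Mβ.inclX d * (Mβ.inclX Γ₀ * Mβ.epsPM)⁻¹) *
            (Mβ.inclX Γ₀ * Mβ.epsPM) := by rw [h, inv_inv]
      _ = Mβ.inclX d := by group
  have hfix : ∀ T : Subgroup Mβ.PiTemp, T ≤ Mβ.decomp xβ →
      MulAut.conj (Mβ.inclX Γ₀ * Mβ.epsPM)⁻¹ • T.map Mβ.inclX = T.map Mβ.inclX := by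
    intro T hT
    ext y
    rw [Subgroup.mem_smul_pointwise_iff_exists]
    constructor
    · rintro ⟨_, ⟨d, hd, rfl⟩, rfl⟩
      rw [MulAut.smul_def, MulAut.conj_apply, key d (hT hd)]
      exact ⟨d, hd, rfl⟩
    · rintro ⟨d, hd, rfl⟩
      exact ⟨Mβ.inclX d, ⟨d, hd, rfl⟩, by rw [MulAut.smul_def, MulAut.conj_apply, key d (hT hd)]⟩
  refine GalSect.CuspPair.ext' ?_ ?_
  · change (((cuspPairOf Mα.toTemperedCurve xα).pushforward Mα.inclX).D).map _ =
      ((cuspPairOf Mβ.toTemperedCurve xβ).pushforward Mβ.inclX).D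
    rw [GalSect.CuspPair.pushforward_D, GalSect.CuspPair.pushforward_D]
    change ((Mα.decomp xα).map Mα.inclX).map _ = (Mβ.decomp xβ).map Mβ.inclX
    rw [map_trans_innerAutC_map_inclX H, hX0, DotCCusp.map_inclX_conj_smul, smul_smul, ← map_mul, hc]
    exact hfix _ le_rfl
  · rw [GalSect.CuspPair.map_I]
    change ((Mα.toThetaSetting.toTemperedCurve.inertia xα).map Mα.inclX).map _ =
      (Mβ.toThetaSetting.toTemperedCurve.inertia xβ).map Mβ.inclX
    rw [map_trans_innerAutC_map_inclX H, map_inertia_eq_of_map_decomp_eq H hX0 hΔX, DotCCusp.map_inclX_conj_smul,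
      smul_smul, ← map_mul, hc]
    exact hfix _ inf_le_left

omit [T1Space Mβ.GtpC] in
/-- In the second case the conjugator lies in `Π^tp_Ċβ` iff `g₁ ∉ Π^tp_Ċβ` (index `2`). [cite: MochizukiEtTh2009, Def 1.7 p.27] -/
theorem inv_mul_epsPM_mem_dotC_of_not_mem (hZβ : Mβ.IsAdmissibleEpsZ εβ) {k Γ₀ : Mβ.PiTemp}
    (hk : Mβ.inclX k ∉ Mβ.dotC εβ) (hnot : Mβ.inclX Γ₀ * Mβ.epsPM ∉ Mβ.dotC εβ) :
    (Mβ.inclX (k * Γ₀) * Mβ.epsPM)⁻¹ ∈ Mβ.dotC εβ := by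
  refine Subgroup.inv_mem _ ?_
  rw [map_mul, mul_assoc]
  exact (Subgroup.mul_mem_iff_of_index_two (Mβ.index_dotC hZβ)).2 (iff_of_false hk hnot)

/-- **[EtTh] Thm. 1.10 (iii) AS TYPED at the two produced cusp data — WITHOUT (ct)**: from (x₀) the plain X-level cusp transport
(`k ∈ Π^tp_{Xβ}` arbitrary), (ΔX) = F-0007 BY NAME, the β-side `ε_±`-data {`Γ₀`, `g₁ ∉ Π^tp_Ċβ`} (used ONLY when `inclX k ∉ Π^tp_Ċβ`),
and (b3) for the class transports.  Nothing else on the α side; no commensurable terminality anywhere.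
[cite: MochizukiEtTh2009, Thm 1.10 (iii) p.30] -/
theorem thm110iiiGalSect_ofStructureGroupIso_of_decompTransport
    {k : Mβ.PiTemp} (hX0 : (Mα.decomp xα).map H.γX.toMulEquiv.toMonoidHom = MulAut.conj k • Mβ.decomp xβ)
    {Γ₀ : Mβ.PiTemp} (hΓ₀ : ∀ d ∈ Mβ.decomp xβ, Mβ.epsPM * Mβ.inclX d * Mβ.epsPM⁻¹ = Mβ.inclX (Γ₀⁻¹ * d * Γ₀))
    (hnot : Mβ.inclX Γ₀ * Mβ.epsPM ∉ Mβ.dotC εβ)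
    (Fα Fβ : Literature.AnabelianGeometry.AbsoluteAnabelian.FundamentalExtension.{0})
    (fα : Fα.arith ≃ₜ* Mα.PiHat) (fβ : Fβ.arith ≃ₜ* Mβ.PiHat)
    (hfα : Fα.geom.map fα.toMulEquiv.toMonoidHom = Mα.DeltaHat) (hfβ : Fβ.geom.map fβ.toMulEquiv.toMonoidHom = Mβ.DeltaHat)
    (h138 : ∀ Φ : Mα.PiHat ≃ₜ* Mβ.PiHat, (∀ y : Mα.PiTemp, Φ (Mα.toHat y) = Mβ.toHat (H.γX y)) →
      Literature.AnabelianGeometry.AbsoluteAnabelian.FundamentalExtension.PreservesGeom (F := Fβ) (fα.trans (Φ.trans fβ.symm)))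
    (hecan : ∀ c ∈ Mβ.dotC εβ,
      ∀ (t : (ofStructureGroupIso eα εα hxα hDα hS₀α κα).pair.SplittingClass →
        (ofStructureGroupIso eβ εβ hxβ hDβ hS₀β κβ).pair.SplittingClass),
      (∀ (S : Subgroup Mα.GtpC) (hS : S ∈ (ofStructureGroupIso eα εα hxα hDα hS₀α κα).pair.splittings),
        ∃ h', t (GalSect.CuspPair.SplittingClass.mk (ofStructureGroupIso eα εα hxα hDα hS₀α κα).pair S hS) =
          GalSect.CuspPair.SplittingClass.mk (ofStructureGroupIso eβ εβ hxβ hDβ hS₀β κβ).pair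
            (S.map (H.Γ.trans (Mβ.innerAutC c)).toMulEquiv.toMonoidHom) h') →
      t '' (ofStructureGroupIso eα εα hxα hDα hS₀α κα).canonical ⊆ (ofStructureGroupIso eβ εβ hxβ hDβ hS₀β κβ).canonical) :
    Thm110iiiGalSect H Sα Sβ (ofStructureGroupIso eα εα hxα hDα hS₀α κα) (ofStructureGroupIso eβ εβ hxβ hDβ hS₀β κβ) := by
  classical
  obtain ⟨Φ, hΦ⟩ := Mα.toThetaSetting.toTemperedCurve.exists_isoCompletion Mβ.toThetaSetting.toTemperedCurve H.γX
  have hΔX : Mα.toThetaSetting.toTemperedCurve.DeltaTemp.map H.γX.toMulEquiv.toMonoidHom =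
      Mβ.toThetaSetting.toTemperedCurve.DeltaTemp :=
    Mα.toThetaSetting.map_deltaTemp_eq_of_preservesGeom_iso Mβ.toThetaSetting H.γX Φ hΦ Fα Fβ fα fβ hfα hfβ (h138 Φ hΦ)
  by_cases hk : Mβ.inclX k ∈ Mβ.dotC εβ
  · have hc : (Mβ.inclX k)⁻¹ ∈ Mβ.dotC εβ := Subgroup.inv_mem _ hk
    exact thm110iiiGalSect_of_genuineTorsor_v3 H Sα Sβ _ _ hc
      (hpair_ofStructureGroupIso_of_mem H eα hxα hDα hS₀α κα eβ hxβ hDβ hS₀β κβ hX0 hΔX)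
      (map_inclX_mem_splittings eα hS₀α) (map_inclX_mem_splittings eβ hS₀β)
      (ofStructureGroupIso_hgen eα εα hxα hDα hS₀α κα) (ofStructureGroupIso_hgen eβ εβ hxβ hDβ hS₀β κβ) (hecan _ hc)
  · have hc := inv_mul_epsPM_mem_dotC_of_not_mem (εβ := εβ) H.admβ hk hnot
    exact thm110iiiGalSect_of_genuineTorsor_v3 H Sα Sβ _ _ hc
      (hpair_ofStructureGroupIso_of_not_mem H eα hxα hDα hS₀α κα eβ hxβ hDβ hS₀β κβ hX0 hΔX hΓ₀)
      (map_inclX_mem_splittings eα hS₀α) (map_inclX_mem_splittings eβ hS₀β)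
      (ofStructureGroupIso_hgen eα εα hxα hDα hS₀α κα) (ofStructureGroupIso_hgen eβ εβ hxβ hDβ hS₀β κβ) (hecan _ hc)

omit [T1Space Mα.GtpC] [T1Space Mβ.GtpC] in
include hxα in
/-- **(x₀) BY NAME**: [SemiAnbd] Thm. 6.5 (iii) for `γ_X` + the uniqueness of the cusp of `Xβ` (C16) give the plain X-level transport.
[cite: MochizukiSemiAnbd2006, Thm 6.5(iii) p.72] -/
theorem exists_conj_decomp_eq_of_isoPreservesCuspidalDecomp
    (h65 : Mα.toThetaSetting.toTemperedCurve.IsoPreservesCuspidalDecomp Mβ.toThetaSetting.toTemperedCurve)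
    (huniq : ∀ x' : Mβ.Pt, Mβ.IsCusp x' → x' = xβ) :
    ∃ k : Mβ.PiTemp, (Mα.decomp xα).map H.γX.toMulEquiv.toMonoidHom = MulAut.conj k • Mβ.decomp xβ := by
  obtain ⟨x', hx', g, hg⟩ := (h65 H.γX (Mα.decomp xα)).1 ⟨xα, hxα, 1, (one_smul _ _).symm⟩
  refine ⟨ConjAct.ofConjAct g, ?_⟩
  rw [hg, huniq x' hx', SettingModel.conj_smul_eq_toConjAct_smul, ConjAct.toConjAct_ofConjAct]

/-- **Thm. 1.10 (iii) AS TYPED at the produced data, (x₀) BY NAME**: residual = {[SemiAnbd] 6.5 (iii) `IsoPreservesCuspidalDecomp`, C16,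
F-0007, β-side `Γ₀` + `g₁ ∉ Π^tp_Ċβ`, (b3) [GalSect] Cor. 4.12}. [cite: MochizukiEtTh2009, Thm 1.10 (iii) p.30] -/
theorem thm110iiiGalSect_ofStructureGroupIso_of_isoPreservesCuspidalDecomp
    (h65 : Mα.toThetaSetting.toTemperedCurve.IsoPreservesCuspidalDecomp Mβ.toThetaSetting.toTemperedCurve)
    (huniq : ∀ x' : Mβ.Pt, Mβ.IsCusp x' → x' = xβ)
    {Γ₀ : Mβ.PiTemp} (hΓ₀ : ∀ d ∈ Mβ.decomp xβ, Mβ.epsPM * Mβ.inclX d * Mβ.epsPM⁻¹ = Mβ.inclX (Γ₀⁻¹ * d * Γ₀))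
    (hnot : Mβ.inclX Γ₀ * Mβ.epsPM ∉ Mβ.dotC εβ)
    (Fα Fβ : Literature.AnabelianGeometry.AbsoluteAnabelian.FundamentalExtension.{0})
    (fα : Fα.arith ≃ₜ* Mα.PiHat) (fβ : Fβ.arith ≃ₜ* Mβ.PiHat)
    (hfα : Fα.geom.map fα.toMulEquiv.toMonoidHom = Mα.DeltaHat) (hfβ : Fβ.geom.map fβ.toMulEquiv.toMonoidHom = Mβ.DeltaHat)
    (h138 : ∀ Φ : Mα.PiHat ≃ₜ* Mβ.PiHat, (∀ y : Mα.PiTemp, Φ (Mα.toHat y) = Mβ.toHat (H.γX y)) →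
      Literature.AnabelianGeometry.AbsoluteAnabelian.FundamentalExtension.PreservesGeom (F := Fβ) (fα.trans (Φ.trans fβ.symm)))
    (hecan : ∀ c ∈ Mβ.dotC εβ,
      ∀ (t : (ofStructureGroupIso eα εα hxα hDα hS₀α κα).pair.SplittingClass →
        (ofStructureGroupIso eβ εβ hxβ hDβ hS₀β κβ).pair.SplittingClass),
      (∀ (S : Subgroup Mα.GtpC) (hS : S ∈ (ofStructureGroupIso eα εα hxα hDα hS₀α κα).pair.splittings),
        ∃ h', t (GalSect.CuspPair.SplittingClass.mk (ofStructureGroupIso eα εα hxα hDα hS₀α κα).pair S hS) =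
          GalSect.CuspPair.SplittingClass.mk (ofStructureGroupIso eβ εβ hxβ hDβ hS₀β κβ).pair
            (S.map (H.Γ.trans (Mβ.innerAutC c)).toMulEquiv.toMonoidHom) h') →
      t '' (ofStructureGroupIso eα εα hxα hDα hS₀α κα).canonical ⊆ (ofStructureGroupIso eβ εβ hxβ hDβ hS₀β κβ).canonical) :
    Thm110iiiGalSect H Sα Sβ (ofStructureGroupIso eα εα hxα hDα hS₀α κα) (ofStructureGroupIso eβ εβ hxβ hDβ hS₀β κβ) := by
  obtain ⟨k, hX0⟩ := exists_conj_decomp_eq_of_isoPreservesCuspidalDecomp H hxα h65 huniq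
  exact thm110iiiGalSect_ofStructureGroupIso_of_decompTransport H Sα Sβ eα hxα hDα hS₀α κα eβ hxβ hDβ hS₀β κβ hX0 hΓ₀ hnot
    Fα Fβ fα fβ hfα hfβ h138 hecan

end ProducedTransport

end Literature.AnabelianGeometry.EtaleTheta
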